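import Summits.QuantumFields.BalabanUV.Beta.MultiscaleBoxDistance
import Summits.QuantumFields.BalabanUV.Beta.TorusBoxSupersolution
import Summits.QuantumFields.BalabanUV.Beta.MultiscaleAveragingPointwise
import Summits.QuantumFields.BalabanUV.Beta.AccretiveCombesThomasSandwichSite

/-!
# `Summit.QuantumFields.BalabanUV.Beta.MultiscaleRegularitySource` — engine file 16b: the KATO SOURCE of the MODEL operator on a
# coordinate box, in the currency of file 9b's local-regularity datum `hreg` — `‖(D*Df)(x,·)‖ ≤ √|Cp|·(m′ + a_max·Γ²·√(Γ^d)·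
# n(x₀)⁻²·√(n(x₀)^{−d}·Σ_{d_n-ball} f²))` when `|levelOp f| ≤ m′` on the `d_n`-ball and `x` is `d_n`-close to `x₀` — plus the
# mean-value binder in files 12∕14∕15's `W·z ≤ Nz` currency from its normalized form, and the fibre∕box∕ball bookkeeping of the
# owner's assembly `MultiscaleRegularityOfMeanValue` (file 16c)

HONEST FRAMING (page 1 of everything in this cell).  Discharging `FlowStep.BetaPertH` would make Bałaban's ultraviolet
stability UNCONDITIONAL — a constructive-QFT result; it is NOT the continuum limit and NOT the Clay problem.  This module
discharges nothing of `BetaPertH`; it is [folklore] finite-dimensional bookkeeping about the MODEL operator, kernel-checked, by the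
OWNER of binder row D4 (unit `b2b-balaban-beta-an4`, gen 45).  HONEST DEPENDENCY: continuum YM on T⁴ ⇐ BetaPertH ∧ nine spine
estimates (0/9 proved); BetaPertH ⇐ (D1) ∧ (D4) ∧ CAP+tail; G-an2-4 gates asym, D1 and NE2/3/4.

THE POINT.  In beta-d4-p3's reduction (`SubsolutionMeanValue`) the fibre norm `‖f(x,·)‖` is a sub-solution of the free weighted
Laplacian with source `‖(D*Df)(x,·)‖` (file 12, Kato).  For the MODEL operator `levelOp = D*D + Σ_l a_l G_lᵀG_l` the source splits as
`D*Df = (levelOp f) − Σ_l a_l G_lᵀG_l f`; the first piece is what `hreg` assumes bounded (`≤ m′` on the `d_n`-ball of radius `ρ₀`),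
the second is file 10a's (P) budget `a_max·n(x)⁻²·√(n(x)^{−d}·Σ_{cell(x)} f²)`.  Under beta-d4-p2's additive grading the scale on the
ball is comparable to the scale at the centre (`n(x₀) ≤ Γ·n(x)`, file 16a) and the cell of a ball site stays in a slightly larger
ball (K4's corner thresholds: `cell_in_ball`), so the whole source is bounded on the box in `hreg`'s currency
(**`source_le_on_box`**).  §2 converts the normalized mean-value binder «`2d·z(x) ≤ Σ_μ(z(x+e_μ) + z(x−e_μ))` on the box ⟹
`z(x₀) ≤ C_MV·(2r+1)^{−d}·Σ_{box} z`» into file 15b's hypothesis shape for a constant bond weight (**`meanValue_binder_of_normalized`**).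

WHAT IS CERTIFIED (kernel, 0 sorry, 0 def): §1 `abs_le_fibreNorm`, `fibreNorm_le_sqrt_card_mul`, `sum_box_fibre_le_sum`,
`card_box_le` (`#box ≤ (2r+1)^d`, b05 `ballCard_le`); §2 `meanValue_binder_of_normalized`; §3 `cell_in_ball`,
**`abs_levelSum_le_on_box`**, **`source_le_on_box`**.  LOCATORS (shape only; ABSOLUTE RULE — nothing printed is asserted):
[Balaban1985BackgroundPropagators] (3.16) p. 393, (3.23) p. 394, Thm 3.1 (3.42) p. 397; [Balaban1984PropagatorsII] (2.46) p. 231.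
Row D4: NO class change (critical-path width 0; D4 DISCHARGE NO DATE); NOT BetaPertH, NOT continuum, NOT Clay, NOT summit progress.
-/

open scoped BigOperators
open Finset

namespace Summit.QuantumFields.BalabanUV.Beta.MultiscaleRegularitySource

open Summit.QuantumFields.BalabanUV.Beta.BoxPoincare (Box)
open Summit.QuantumFields.BalabanUV.Beta.MultiscaleCoerciveTorus
open Summit.QuantumFields.BalabanUV.Beta.MultiscaleDistance
open Summit.QuantumFields.BalabanUV.Beta.MultiscaleDecayBudget
open Summit.QuantumFields.BalabanUV.Beta.MultiscaleDecay (hc_levelOp decay_levelOp)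
open Summit.QuantumFields.BalabanUV.Beta.AccretiveCombesThomasSandwichSite (abs_sdist_sub_corner_le)
open Summit.QuantumFields.BalabanUV.Beta.MultiscaleAveragingPointwise (abs_levelSum_apply_le)
open Summit.QuantumFields.BalabanUV.Beta.MultiscaleBoxDistance (scale_ge_of_sdist_le sdist_le_of_dist_le)
open Summit.QuantumFields.BalabanUV.Beta.TorusBoxSupersolution (fibreNorm_le_l2_box sum_src_const sum_tgt_const wsum_src_const
  wsum_tgt_const)
open Summit.QuantumFields.BalabanUV.Beta.SubsolutionMeanValue (sqrt_sum_sq_sub_le)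
open Literature.MathematicalPhysics.QuantumFieldTheory.Balaban1983to89
open Literature.MathematicalPhysics.QuantumFieldTheory.Balaban1983to89.B9Thm37Glue (covD covDT)
open Literature.MathematicalPhysics.QuantumFieldTheory.Balaban1983to89.B9Thm37GluePU (bsrc btgt)
open Literature.MathematicalPhysics.QuantumFieldTheory.Balaban1983to89.B9Thm37GlueTorusCov (tblk)
open Literature.MathematicalPhysics.QuantumFieldTheory.Balaban1983to89.B9Thm37GlueTorusCovLevels (levelOp levelSum)
open B4Sect5Torus (tdist tdist_symm)
open B5TorusCover (UT Ctr ctrU ballCard_le_real)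
open B5Leibniz121 (up dn)

noncomputable section

variable {d : ℕ} {N : Fin d → ℕ} [∀ i, NeZero (N i)]

/-! ## §1 Fibre and ball bookkeeping -/

omit [∀ i, NeZero (N i)] in
/-- A component is at most the fibre norm: `|f(x,i)| ≤ √(Σ_j f(x,j)²)`. [folklore] -/
theorem abs_le_fibreNorm {Cp : Type} [Fintype Cp] (f : UT N × Cp → ℝ) (x : UT N) (i : Cp) :
    |f (x, i)| ≤ Real.sqrt (∑ j, f (x, j) ^ 2) := by
  rw [← Real.sqrt_sq_eq_abs]
  exact Real.sqrt_le_sqrt (Finset.single_le_sum (fun j _ => sq_nonneg (f (x, j))) (mem_univ i))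

/-- A uniform componentwise bound gives the fibre-norm bound `√(Σ_i g_i²) ≤ √|Cp|·B`. [folklore] -/
theorem fibreNorm_le_sqrt_card_mul {Cp : Type} [Fintype Cp] (g : Cp → ℝ) {B : ℝ} (hB : 0 ≤ B) (h : ∀ i, |g i| ≤ B) :
    Real.sqrt (∑ i, g i ^ 2) ≤ Real.sqrt (Fintype.card Cp) * B := by
  have h1 : ∑ i, g i ^ 2 ≤ Fintype.card Cp * B ^ 2 := by
    calc ∑ i, g i ^ 2 ≤ ∑ _i : Cp, B ^ 2 := Finset.sum_le_sum fun i _ => by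
          have := h i; rw [← sq_abs]; exact pow_le_pow_left₀ (abs_nonneg _) this 2
      _ = Fintype.card Cp * B ^ 2 := by rw [Finset.sum_const, Finset.card_univ, nsmul_eq_mul]
  calc Real.sqrt (∑ i, g i ^ 2) ≤ Real.sqrt (Fintype.card Cp * B ^ 2) := Real.sqrt_le_sqrt h1
    _ = Real.sqrt (Fintype.card Cp) * B := by rw [Real.sqrt_mul (Nat.cast_nonneg _), Real.sqrt_sq hB]

omit [∀ i, NeZero (N i)] in
/-- The fibre sums over a set of sites are dominated by the sum over any larger set of site-component pairs. [folklore] -/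
theorem sum_box_fibre_le_sum {Cp : Type} [Fintype Cp] (f : UT N × Cp → ℝ) (Bx : Finset (UT N)) (Bl : Finset (UT N × Cp))
    (h : ∀ x ∈ Bx, ∀ i, (x, i) ∈ Bl) : ∑ x ∈ Bx, ∑ i, f (x, i) ^ 2 ≤ ∑ q ∈ Bl, f q ^ 2 := by
  rw [← Finset.sum_product (s := Bx) (t := (univ : Finset Cp)) (f := fun q => f q ^ 2)]
  refine Finset.sum_le_sum_of_subset_of_nonneg (fun q hq => ?_) fun q _ _ => sq_nonneg _
  obtain ⟨hx, -⟩ := Finset.mem_product.mp hq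
  have := h q.1 hx q.2
  exact this

/-- The coordinate box has at most `(2r+1)^d` sites. [folklore] -/
theorem card_box_le (x₀ : UT N) (r : ℕ) :
    ((univ.filter (fun x : UT N => dist x x₀ ≤ r)).card : ℝ) ≤ (2 * r + 1 : ℝ) ^ d := by
  have h := ballCard_le_real (UT.one_le N) (UT.toSite N x₀) (r := (r : ℝ)) (Nat.cast_nonneg r)
  rw [Nat.floor_natCast] at h
  refine le_trans ?_ h
  have hle : (univ.filter (fun x : UT N => dist x x₀ ≤ r)).card ≤
      (univ.filter fun w : B4Sect5Torus.TSite d N => tdist N (UT.toSite N x₀) w ≤ r).card := by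
    refine Finset.card_le_card_of_injOn (fun x => UT.toSite N x) (fun x hx => ?_) (fun a _ b _ hab => hab)
    have hx' := (Finset.mem_filter.mp (Finset.mem_coe.mp hx)).2
    refine Finset.mem_coe.mpr (Finset.mem_filter.mpr ⟨mem_univ _, ?_⟩)
    rw [tdist_symm (UT.one_le N)]
    rwa [UT.dist_eq] at hx'
  exact_mod_cast hle

/-! ## §2 The binder in the `W·z ≤ Nz` currency of files 12∕14∕15 from its normalized form -/

/-- **From the normalized mean-value binder to the weighted one.**  For a constant bond weight `c ≡ c₀ ≠ 0` on the torus,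
`W(x)·z(x) ≤ (Nz)(x)` reads `2d·c₀²·z(x) ≤ c₀²·Σ_μ (z(x−e_μ) + z(x+e_μ))`, i.e. `2d·z(x) ≤ Σ_μ (z(x+e_μ) + z(x−e_μ))`; so the
binder «`z ≥ 0`, `2d·z ≤ Σ_μ(z(·+e_μ) + z(·−e_μ))` on the box ⟹ `z(x₀) ≤ C_MV·(2r+1)^{−d}·Σ_{box} z`» yields file 15b's hypothesis
`hMV` at `(box, x₀)` with `C = C_MV/(2r+1)^d` and `B′ = box`. [folklore] -/
theorem meanValue_binder_of_normalized [NeZero d] {c : UT N × Fin d → ℝ} {c₀ : ℝ} (hcc : ∀ b, c b = c₀) (hc₀ : c₀ ≠ 0)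
    (x₀ : UT N) (r : ℕ) {CMV : ℝ}
    (hMV : ∀ z : UT N → ℝ, (∀ y, 0 ≤ z y) →
      (∀ x, dist x x₀ ≤ r → 2 * d * z x ≤ ∑ μ, (z (up x μ) + z (dn x μ))) →
      z x₀ ≤ CMV / (2 * r + 1 : ℝ) ^ d * ∑ x ∈ univ.filter (fun x : UT N => dist x x₀ ≤ r), z x) :
    ∀ z : UT N → ℝ, (∀ y, 0 ≤ z y) →
      (∀ x ∈ univ.filter (fun x : UT N => dist x x₀ ≤ r),
        ((∑ b ∈ univ.filter (fun b : UT N × Fin d => btgt b = x), c b ^ 2) +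
            ∑ b ∈ univ.filter (fun b : UT N × Fin d => bsrc b = x), c b ^ 2) * z x ≤
          ((∑ b ∈ univ.filter (fun b : UT N × Fin d => btgt b = x), c b ^ 2 * z (bsrc b)) +
            ∑ b ∈ univ.filter (fun b : UT N × Fin d => bsrc b = x), c b ^ 2 * z (btgt b))) →
      z x₀ ≤ CMV / (2 * r + 1 : ℝ) ^ d * ∑ x ∈ univ.filter (fun x : UT N => dist x x₀ ≤ r), z x := by
  intro z hz hsub
  refine hMV z hz fun x hx => ?_
  have h := hsub x (mem_filter.mpr ⟨mem_univ _, hx⟩)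
  rw [sum_tgt_const hcc, sum_src_const hcc, wsum_tgt_const hcc, wsum_src_const hcc] at h
  have hc2 : (0 : ℝ) < c₀ ^ 2 := by positivity
  have h' : c₀ ^ 2 * (2 * d * z x) ≤ c₀ ^ 2 * ∑ μ, (z (up x μ) + z (dn x μ)) := by
    rw [Finset.sum_add_distrib]
    have e1 : c₀ ^ 2 * (2 * (d : ℝ) * z x) = ((d : ℝ) * c₀ ^ 2 + d * c₀ ^ 2) * z x := by ring
    have e2 : c₀ ^ 2 * (∑ μ, z (up x μ) + ∑ μ, z (dn x μ)) = c₀ ^ 2 * ∑ μ, z (dn x μ) + c₀ ^ 2 * ∑ μ, z (up x μ) := by ring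
    rw [e1, e2]; exact h
  exact le_of_mul_le_mul_left h' hc2

/-! ## §3 The analytic setting of `MultiscaleDecay.hc_levelOp` (as in files 7–13) and the source bound on the box -/

variable [NeZero d] {Cp J K : Type} [Fintype Cp] [DecidableEq Cp] [Nonempty Cp]
  [Fintype J] [Fintype K] [DecidableEq K] (S : J → ℕ) (hS : ∀ l, 1 ≤ S l) (hdivS : ∀ l i, S l ∣ N i) (lvl : K → J)
  (zc : (k : K) → Ctr N (S (lvl k)))

omit [Fintype Cp] [DecidableEq Cp] [Nonempty Cp] [Fintype J] [Fintype K] [DecidableEq K] in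
/-- **Cells of ball sites stay in a slightly larger ball**: if `d_n(x, x₀) ≤ s` then every site `q` of the cell of `x` has
`d_n(q, x₀) ≤ s + 4d` (K4's corner thresholds twice). [folklore] -/
theorem cell_in_ball (hdisj : ∀ k k' v v', cellPt S hS hdivS lvl zc k v = cellPt S hS hdivS lvl zc k' v' → k = k')
    (hcover : ∀ x : UT N, ∃ k, ∃ v : Box d (S (lvl k)), cellPt S hS hdivS lvl zc k v = x) {x x₀ q : UT N} {s : ℝ}
    (hx : sdist bsrc btgt (siteScale S hS hdivS lvl zc hcover) x x₀ ≤ s)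
    (hq : cellOf S hS hdivS lvl zc hcover q = cellOf S hS hdivS lvl zc hcover x) :
    sdist bsrc btgt (siteScale S hS hdivS lvl zc hcover) q x₀ ≤ s + 4 * d := by
  have h1 := abs_sdist_sub_corner_le S hS hdivS lvl zc hdisj hcover q x₀
  have h2 := abs_sdist_sub_corner_le S hS hdivS lvl zc hdisj hcover x x₀
  rw [hq] at h1
  have h1' := (abs_sub_le_iff.mp h1).1
  have h2' := (abs_sub_le_iff.mp h2).2
  linarith

variable
    (hdisj : ∀ k k' v v', cellPt S hS hdivS lvl zc k v = cellPt S hS hdivS lvl zc k' v' → k = k')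
    (hcover : ∀ x : UT N, ∃ k, ∃ v : Box d (S (lvl k)), cellPt S hS hdivS lvl zc k v = x)
    (Rm : UT N × Fin d → Cp → Cp → ℝ) (hRm : ∀ b i j, ∑ k, Rm b k i * Rm b k j = if i = j then (1 : ℝ) else 0)
    (T : J → UT N → Cp → Cp → ℝ) (hT : ∀ l x i i', ∑ k, T l x k i * T l x k i' = if i = i' then (1 : ℝ) else 0)
    (a : J → ℝ) (ha : ∀ j, 0 ≤ a j) (ω : J → UT N → ℝ)
    (hsupp : ∀ l x, ω l (ctrU N (S l) (tblk (hS l) (hdivS l) x)) ≠ 0 → ∃ k v, lvl k = l ∧ cellPt S hS hdivS lvl zc k v = x)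
    {amax : ℝ} (hamax : 0 ≤ amax)
    (hscale : ∀ k, a (lvl k) * ω (lvl k) (ctrU N (S (lvl k)) (zc k)) ^ 2 * (S (lvl k) : ℝ) ^ d ≤ amax / (S (lvl k) : ℝ) ^ 2)
    (c : UT N × Fin d → ℝ) {c₀ : ℝ} (hcc : ∀ b, c b = c₀) (hc₀ : c₀ ≠ 0)
    {L : ℕ} (hL : 1 ≤ L) (e : J → ℕ) (hSe : ∀ l, S l = L ^ e l) {R : ℝ} (hR : 0 < R) {A : ℕ}
    (hadd : ∀ x y : UT N, |(e (lvl (cellOf S hS hdivS lvl zc hcover x)) : ℝ) - e (lvl (cellOf S hS hdivS lvl zc hcover y))| ≤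
      A + sdist bsrc btgt (siteScale S hS hdivS lvl zc hcover) x y / R)

include hdisj hT ha hsupp hamax hscale hL e hSe hR hadd

omit [Nonempty Cp] [Fintype K] in
/-- **The (P) part of the source on a ball site, in `hreg`'s currency.**  With `Γ = L^A·e^{(log L/R)ρ₀}` and `n₀ = n(x₀)`: if
`d_n(x, x₀) ≤ s` with `s + 4d ≤ ρ₀` (so the cell of `x` lies in the `ρ₀`-ball and `n₀ ≤ Γ·n(x)`), then for every component `i`
`|(Σ_l a_l G_lᵀG_l f)(x,i)| ≤ a_max·Γ²·√(Γ^d)·n₀⁻²·√(n₀^{−d}·Σ_{d_n(q,x₀) ≤ ρ₀} f(q)²)` (file 10a + the grading). [folklore] -/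
theorem abs_levelSum_le_on_box (f : UT N × Cp → ℝ) {x x₀ : UT N} {s ρ₀ : ℝ} (hsρ : s + 4 * d ≤ ρ₀)
    (hx : sdist bsrc btgt (siteScale S hS hdivS lvl zc hcover) x x₀ ≤ s) (i : Cp) :
    |levelSum (fun l x => ctrU N (S l) (tblk (hS l) (hdivS l) x)) (fun l x => ω l (ctrU N (S l) (tblk (hS l) (hdivS l) x))) T a
        f (x, i)| ≤
      amax * ((L : ℝ) ^ A * Real.exp (Real.log L / R * ρ₀)) ^ 2 *
        Real.sqrt (((L : ℝ) ^ A * Real.exp (Real.log L / R * ρ₀)) ^ d) *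
        ((siteScale S hS hdivS lvl zc hcover x₀ : ℝ) ^ 2)⁻¹ *
        Real.sqrt (((siteScale S hS hdivS lvl zc hcover x₀ : ℝ) ^ d)⁻¹ *
          ∑ q ∈ univ.filter (fun q : UT N × Cp => sdist bsrc btgt (siteScale S hS hdivS lvl zc hcover) q.1 x₀ ≤ ρ₀), f q ^ 2) := by
  set n := siteScale S hS hdivS lvl zc hcover with hn
  set Γ : ℝ := (L : ℝ) ^ A * Real.exp (Real.log L / R * ρ₀) with hΓ
  set Bl := univ.filter (fun q : UT N × Cp => sdist bsrc btgt n q.1 x₀ ≤ ρ₀) with hBl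
  have hd0 : (0 : ℝ) ≤ d := Nat.cast_nonneg _
  have hnx : (0 : ℝ) < n x := by exact_mod_cast one_le_siteScale S hS hdivS lvl zc hcover x
  have hn0 : (0 : ℝ) < n x₀ := by exact_mod_cast one_le_siteScale S hS hdivS lvl zc hcover x₀
  -- file 10a at the cell of `x`
  have h10 := abs_levelSum_apply_le S hS hdivS lvl zc hdisj hcover T hT a ha ω hsupp hamax hscale f (x, i)
    (cellOf S hS hdivS lvl zc hcover x) rfl
  have hSk : (S (lvl (cellOf S hS hdivS lvl zc hcover x)) : ℝ) = n x := by rw [hn, siteScale]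
  rw [hSk] at h10
  -- the cell of `x` lies in the `ρ₀`-ball
  have hcell : ∑ q ∈ univ.filter (fun q : UT N × Cp => cellOf S hS hdivS lvl zc hcover q.1 = cellOf S hS hdivS lvl zc hcover x),
      f q ^ 2 ≤ ∑ q ∈ Bl, f q ^ 2 := by
    refine Finset.sum_le_sum_of_subset_of_nonneg (fun q hq => ?_) fun q _ _ => sq_nonneg _
    rw [hBl, mem_filter]
    exact ⟨mem_univ _, (cell_in_ball S hS hdivS lvl zc hdisj hcover hx (mem_filter.mp hq).2).trans hsρ⟩
  -- the grading: `n x₀ ≤ Γ n x`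
  have hgr : ∀ y, (n y : ℝ) = L ^ (e (lvl (cellOf S hS hdivS lvl zc hcover y))) := fun y => by
    rw [hn, siteScale, hSe]; push_cast; rfl
  have hsc : (n x₀ : ℝ) ≤ Γ * n x :=
    scale_ge_of_sdist_le n hL (fun y => e (lvl (cellOf S hS hdivS lvl zc hcover y)))
      (fun y => by exact_mod_cast (hgr y)) hR (A := A) (hadd x x₀) (hx.trans (by linarith))
  have hΓ1 : 0 < Γ := by positivity
  -- exchange the scales: `(n x)⁻² ≤ Γ² (n x₀)⁻²`, `(n x)^{-d} ≤ Γ^d (n x₀)^{-d}`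
  have hinv2 : ((n x : ℝ) ^ 2)⁻¹ ≤ Γ ^ 2 * ((n x₀ : ℝ) ^ 2)⁻¹ := by
    have hpow : (n x₀ : ℝ) ^ 2 ≤ Γ ^ 2 * (n x : ℝ) ^ 2 := by rw [← mul_pow]; exact pow_le_pow_left₀ hn0.le hsc 2
    calc ((n x : ℝ) ^ 2)⁻¹ = Γ ^ 2 * (Γ ^ 2 * (n x : ℝ) ^ 2)⁻¹ := by field_simp
      _ ≤ Γ ^ 2 * ((n x₀ : ℝ) ^ 2)⁻¹ := by gcongr
  have hinvd : (((n x : ℝ)) ^ d)⁻¹ ≤ Γ ^ d * (((n x₀ : ℝ)) ^ d)⁻¹ := by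
    have hpow : (n x₀ : ℝ) ^ d ≤ Γ ^ d * (n x : ℝ) ^ d := by rw [← mul_pow]; exact pow_le_pow_left₀ hn0.le hsc d
    calc (((n x : ℝ)) ^ d)⁻¹ = Γ ^ d * (Γ ^ d * (n x : ℝ) ^ d)⁻¹ := by field_simp
      _ ≤ Γ ^ d * (((n x₀ : ℝ)) ^ d)⁻¹ := by gcongr
  have hsum0 : 0 ≤ ∑ q ∈ Bl, f q ^ 2 := Finset.sum_nonneg fun q _ => sq_nonneg _
  have hsq : Real.sqrt ((((n x : ℝ)) ^ d)⁻¹ * ∑ q ∈ univ.filter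
      (fun q : UT N × Cp => cellOf S hS hdivS lvl zc hcover q.1 = cellOf S hS hdivS lvl zc hcover x), f q ^ 2) ≤
      Real.sqrt (Γ ^ d) * Real.sqrt ((((n x₀ : ℝ)) ^ d)⁻¹ * ∑ q ∈ Bl, f q ^ 2) := by
    rw [← Real.sqrt_mul (by positivity), ← mul_assoc]
    exact Real.sqrt_le_sqrt (mul_le_mul hinvd hcell (Finset.sum_nonneg fun q _ => sq_nonneg _) (by positivity))
  calc |levelSum (fun l x => ctrU N (S l) (tblk (hS l) (hdivS l) x)) (fun l x => ω l (ctrU N (S l) (tblk (hS l) (hdivS l) x)))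
          T a f (x, i)|
      ≤ amax * ((n x : ℝ) ^ 2)⁻¹ * Real.sqrt ((((n x : ℝ)) ^ d)⁻¹ * ∑ q ∈ univ.filter
          (fun q : UT N × Cp => cellOf S hS hdivS lvl zc hcover q.1 = cellOf S hS hdivS lvl zc hcover x), f q ^ 2) := h10
    _ ≤ amax * (Γ ^ 2 * ((n x₀ : ℝ) ^ 2)⁻¹) * (Real.sqrt (Γ ^ d) * Real.sqrt ((((n x₀ : ℝ)) ^ d)⁻¹ * ∑ q ∈ Bl, f q ^ 2)) := by
        gcongr
    _ = _ := by ring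

omit [Fintype K] in
/-- **THE KATO SOURCE ON THE BOX.**  If `|Af| ≤ m′` at every site-component of the `ρ₀`-ball about `x₀` (`A = levelOp`) and
`d_n(x, x₀) ≤ s`, `s + 4d ≤ ρ₀`, then the fibre norm of `D*Df = Af − Σ_l a_l G_lᵀG_l f` at `x` is at most
`√|Cp|·(m′ + a_max·Γ²·√(Γ^d)·n₀⁻²·√(n₀^{−d}·Σ_{ball} f²))`. [cite: Balaban1985BackgroundPropagators, (3.16) p.393 + (3.23) p.394] [folklore] -/
theorem source_le_on_box (f : UT N × Cp → ℝ) {x x₀ : UT N} {s ρ₀ m' : ℝ} (hsρ : s + 4 * d ≤ ρ₀)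
    (hx : sdist bsrc btgt (siteScale S hS hdivS lvl zc hcover) x x₀ ≤ s)
    (hAf : ∀ q : UT N × Cp, sdist bsrc btgt (siteScale S hS hdivS lvl zc hcover) q.1 x₀ ≤ ρ₀ →
      |levelOp bsrc btgt c Rm (fun l x => ctrU N (S l) (tblk (hS l) (hdivS l) x))
        (fun l x => ω l (ctrU N (S l) (tblk (hS l) (hdivS l) x))) T a f q| ≤ m') :
    Real.sqrt (∑ i, (covDT bsrc btgt c Rm (covD bsrc btgt c Rm f) (x, i)) ^ 2) ≤
      Real.sqrt (Fintype.card Cp) * (m' + amax * ((L : ℝ) ^ A * Real.exp (Real.log L / R * ρ₀)) ^ 2 *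
        Real.sqrt (((L : ℝ) ^ A * Real.exp (Real.log L / R * ρ₀)) ^ d) *
        ((siteScale S hS hdivS lvl zc hcover x₀ : ℝ) ^ 2)⁻¹ *
        Real.sqrt (((siteScale S hS hdivS lvl zc hcover x₀ : ℝ) ^ d)⁻¹ *
          ∑ q ∈ univ.filter (fun q : UT N × Cp => sdist bsrc btgt (siteScale S hS hdivS lvl zc hcover) q.1 x₀ ≤ ρ₀), f q ^ 2)) := by
  set Aop := levelOp bsrc btgt c Rm (fun l x => ctrU N (S l) (tblk (hS l) (hdivS l) x))
    (fun l x => ω l (ctrU N (S l) (tblk (hS l) (hdivS l) x))) T a with hAop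
  set Pop := levelSum (fun l x => ctrU N (S l) (tblk (hS l) (hdivS l) x))
    (fun l x => ω l (ctrU N (S l) (tblk (hS l) (hdivS l) x))) T a with hPop
  have hxball : sdist bsrc btgt (siteScale S hS hdivS lvl zc hcover) x x₀ ≤ ρ₀ := hx.trans (by
    have : (0 : ℝ) ≤ 4 * d := by positivity
    linarith)
  have hm' : 0 ≤ m' := (abs_nonneg _).trans (hAf (x, Classical.arbitrary Cp) hxball)
  -- `D*Df = Af − Pf` pointwise
  have hsplit : ∀ i, covDT bsrc btgt c Rm (covD bsrc btgt c Rm f) (x, i) = Aop f (x, i) - Pop f (x, i) := by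
    intro i
    have : Aop f (x, i) = covDT bsrc btgt c Rm (covD bsrc btgt c Rm f) (x, i) + Pop f (x, i) := by
      rw [hAop, hPop, levelOp, LinearMap.add_apply, LinearMap.comp_apply, Pi.add_apply]
    linarith
  have hP := fun i => abs_levelSum_le_on_box S hS hdivS lvl zc hdisj hcover T hT a ha ω hsupp hamax hscale hL e hSe hR hadd f hsρ
    hx i
  set PB := amax * ((L : ℝ) ^ A * Real.exp (Real.log L / R * ρ₀)) ^ 2 *
        Real.sqrt (((L : ℝ) ^ A * Real.exp (Real.log L / R * ρ₀)) ^ d) *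
        ((siteScale S hS hdivS lvl zc hcover x₀ : ℝ) ^ 2)⁻¹ *
        Real.sqrt (((siteScale S hS hdivS lvl zc hcover x₀ : ℝ) ^ d)⁻¹ *
          ∑ q ∈ univ.filter (fun q : UT N × Cp => sdist bsrc btgt (siteScale S hS hdivS lvl zc hcover) q.1 x₀ ≤ ρ₀), f q ^ 2)
    with hPB
  have hPB0 : 0 ≤ PB := by rw [hPB]; positivity
  calc Real.sqrt (∑ i, (covDT bsrc btgt c Rm (covD bsrc btgt c Rm f) (x, i)) ^ 2)
      = Real.sqrt (∑ i, (Aop f (x, i) - Pop f (x, i)) ^ 2) := by simp_rw [hsplit]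
    _ ≤ Real.sqrt (∑ i, (Aop f (x, i)) ^ 2) + Real.sqrt (∑ i, (Pop f (x, i)) ^ 2) :=
        sqrt_sum_sq_sub_le (fun i => Aop f (x, i)) (fun i => Pop f (x, i))
    _ ≤ Real.sqrt (Fintype.card Cp) * m' + Real.sqrt (Fintype.card Cp) * PB :=
        add_le_add (fibreNorm_le_sqrt_card_mul _ hm' fun i => hAf (x, i) hxball)
          (fibreNorm_le_sqrt_card_mul _ hPB0 fun i => by rw [hPB]; exact hP i)
    _ = Real.sqrt (Fintype.card Cp) * (m' + PB) := by ring

end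

end Summit.QuantumFields.BalabanUV.Beta.MultiscaleRegularitySource
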